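import Summits.AtomisticToContinuum.Crystallization.Theorems.FrustratedLawDichotomyAperiodicGapRecordJunctionCore
import Summits.AtomisticToContinuum.Crystallization.Theorems.FrustratedLawDichotomyStrainedPatchGradedStage
import HarnessLib

/-!
# FrustratedLawDichotomy · crux `AperiodicFrustratedLawGap` (stmt-AtomisticToContinuum-27623) — RECORD JUNCTION, GRADED-STAGE FORM
# (decomp-a2c, prover hand 2, generation 34; structural share; the first sibling landed THROUGH the [CORE-FAR] junction `…RecordJunctionCore`)

lens-5 g78's node «GradedDescent» (`…StrainedPatchGradedDescent` / `…StrainedPatchGradedStage`, critic row 1275's pre-registered «graded START / stage /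
terminal tables»): the graded certificate leaf (TF-G) `TubeFloorG 𝓘 τ T` of g77's AND-node is DISCHARGED in GRADED TABLE CURRENCY —
`tubeFloorG_of_envelope_tailCert_pairTabsG`: R1⁗ data (host separation, (HFAR), (TAILCERT), column domination, admissible pairing) ∧ (START-G)
`DiffEvalTabG 𝓘 τ T … (boxTabG T) (P 0)` ∧ (STAGE-G)ᵢ `StageCertG 𝓘 τ T σ₁ … Pm (addCol X (P i)) (P (i+1))` ∧ (CERT-G) `SlackCertG 𝓘 τ T 0 σ₁ … (addCol X (P n))`
⟹ (TF-G); with the graded cover (BC-G) this is the T-leaf record `coreOff_of_envelope_tailCert_pairTabsG : … → CoreOffTubeFloor (63/10) (63/10) (24/5) (1/100) 0`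
and its two-level census instance `coreOff_record_of_gradeTol_pairTabs R_g τ_in` (`τ = 1/100`, `T = gradeTol R_g τ_in (1/100)`).

Since this generation's `…RecordJunctionCore` states the crux with [CORE-FAR] itself as the ONE T-binder, the junction of the new record is ONE TERM
(`aperiodicFrustratedLawGap_of_entryTreesHTU_of_coreOff … (coreOff_of_envelope_tailCert_pairTabsG …) …`); this DEF-FREE module records it by name:

* §1 ★★★ `aperiodicFrustratedLawGap_of_entryTreesU_of_envelope_tailCert_pairTabsG` — the crux from the E-spine (HTU consumer of record) ∧ the collar floors ∧ the caps ∧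
  (BC-G) ∧ R1⁗ data ∧ (START-G) ∧ (STAGE-G)ᵢ ∧ (CERT-G), for EVERY family `𝓘`, scalar `τ ≥ 0`, table `T`, per-row targets `P` and stage count `n`; periodic sibling (27624);
* §2 ★★ `aperiodicFrustratedLawGap_of_entryTreesU_of_gradeTol_pairTabs` — the census cell: `τ = 1/100`, `T = gradeTol R_g τ_in (1/100)` (CERT-G / COVER-G / GRAD-77 of
  NODE-g77 §4 run in the SAME cell, critic row 1275's amendment);
* §3 sanity: GradStep's UNIFORM record (`StageCert` / `DiffEvalTab` / `SlackCert` at the constant table) recovered through `…_via_graded` — i.e. §1 contains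
  `…RecordJunctionStage` §2 (an `example`).

One-line compositions; 0 sorry; no definitions; standard axioms.  `--supports stmt-AtomisticToContinuum-27623`.  [folklore instantiation]
-/

noncomputable section

namespace Summit.AtomisticToContinuum.Crystallization.Theorems.FrustratedLawDichotomyAperiodicGapRecordJunctionGradedStage

open Summit.AtomisticToContinuum.Crystallization.Theorems.ChargedEnergyGapNegative (eStar E3)
open Summit.AtomisticToContinuum.Crystallization.Theorems.FrustratedLawDichotomyRangeCut
open Summit.AtomisticToContinuum.Crystallization.Theorems.FrustratedLawDichotomySchurCut
open Summit.AtomisticToContinuum.Crystallization.Theorems.FrustratedLawDichotomyMotifLemmas (GoodAtScale)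
open Summit.AtomisticToContinuum.Crystallization.Theorems.FrustratedLawDichotomyExemptLocOpt (LocOptFails)
open Summit.AtomisticToContinuum.Crystallization.Theorems.FrustratedLawDichotomyExemptSplit (SchurElasticPricingX)
open Summit.AtomisticToContinuum.Crystallization.Theorems.FrustratedLawDichotomyExemptAbsorptionRecord
open Summit.AtomisticToContinuum.Crystallization.Theorems.FrustratedLawDichotomyCollarCensus
open Summit.AtomisticToContinuum.Crystallization.Theorems.FrustratedLawDichotomyCollarCensusKappa
open Summit.AtomisticToContinuum.Crystallization.Theorems.FrustratedLawDichotomyStrainedPatchHomSplit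
open Summit.AtomisticToContinuum.Crystallization.Theorems.FrustratedLawDichotomyStrainedPatchCleanCollar (TailPenalty AnnularDefectFloor DefectiveCollarFloor)
open Summit.AtomisticToContinuum.Crystallization.Theorems.FrustratedLawDichotomyStrainedPatchPhaseCut (AnnularPhaseFloor PolyTextureFloor)
open Summit.AtomisticToContinuum.Crystallization.Theorems.FrustratedLawDichotomyStrainedPatchCoreTube (CoreOffTubeFloor)
open Summit.AtomisticToContinuum.Crystallization.Theorems.FrustratedLawDichotomyStrainedPatchCoreTubeRecord (CoreCoreRelief)
open Summit.AtomisticToContinuum.Crystallization.Theorems.FrustratedLawDichotomyStrainedPatchHostCells (FamilyCover)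
open Summit.AtomisticToContinuum.Crystallization.Theorems.FrustratedLawDichotomyStrainedPatchHomCertTree (CertTree treeOK)
open Summit.AtomisticToContinuum.Crystallization.Theorems.FrustratedLawDichotomyStrainedPatchHomEntryGram (rootC rootW)
open Summit.AtomisticToContinuum.Crystallization.Theorems.FrustratedLawDichotomyStrainedPatchHomEntryGramHcp (rootCH rootWH)
open Summit.AtomisticToContinuum.Crystallization.Theorems.FrustratedLawDichotomyStrainedPatchHomEntryTable (muRec)
open Summit.AtomisticToContinuum.Crystallization.Theorems.FrustratedLawDichotomyStrainedPatchHomEntryTableP (entryLeafOK6RBKP)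
open Summit.AtomisticToContinuum.Crystallization.Theorems.FrustratedLawDichotomyStrainedPatchHomEntryLeafHT (HTCert entryLeafOKHT4UQDCRX)
open Summit.AtomisticToContinuum.Crystallization.Theorems.FrustratedLawDichotomyStrainedPatchQuantSlaving (ChartFam HessTab ForceTab SlackTab hessBlk0 force0)
open Summit.AtomisticToContinuum.Crystallization.Theorems.FrustratedLawDichotomyStrainedPatchSVCharge (SlackCert)
open Summit.AtomisticToContinuum.Crystallization.Theorems.FrustratedLawDichotomyStrainedPatchTaylorCharge (HostSep cubicTail)
open Summit.AtomisticToContinuum.Crystallization.Theorems.FrustratedLawDichotomyStrainedPatchBondCalculus (bondD3)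
open Summit.AtomisticToContinuum.Crystallization.Theorems.FrustratedLawDichotomyStrainedPatchFarSplit (HostFarTab gammaMaj)
open Summit.AtomisticToContinuum.Crystallization.Theorems.FrustratedLawDichotomyStrainedPatchTailPacking (TailCert)
open Summit.AtomisticToContinuum.Crystallization.Theorems.FrustratedLawDichotomyStrainedPatchRowPrice (addCol)
open Summit.AtomisticToContinuum.Crystallization.Theorems.FrustratedLawDichotomyStrainedPatchGradStep (PairMap PairAdm DiffEvalTab boxTab StageCert)
open Summit.AtomisticToContinuum.Crystallization.Theorems.FrustratedLawDichotomyStrainedPatchGradedTube (FamilyCoverG gradeTol)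
open Summit.AtomisticToContinuum.Crystallization.Theorems.FrustratedLawDichotomyStrainedPatchGradedDescent (SlackCertG)
open Summit.AtomisticToContinuum.Crystallization.Theorems.FrustratedLawDichotomyStrainedPatchGradedStage (DiffEvalTabG boxTabG StageCertG
  coreOff_of_envelope_tailCert_pairTabsG coreOff_record_of_gradeTol_pairTabs coreOff_of_envelope_tailCert_pairTabs_via_graded)
open Summit.AtomisticToContinuum.Crystallization.Theorems.FrustratedLawDichotomyAperiodicGapRecordJunctionCore

/-! ## §1 ★★★ The crux BY NAME from the entry trees and the GRADED STAGE record (every family, scalar, table, targets, stage count) -/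

/-- ★★★ **27623 FROM THE ENTRY TREES AND THE GRADED STAGE RECORD** — the crux BY NAME from
`UP ∧ 0 ≤ D_X ∧ Eopt-raw ∧ (∃ fcc tree) ∧ (∃ hcp HT4UQDCRX tree) ∧ TailPenalty ∧ CoreCoreRelief ∧ (BC-G) FamilyCoverG 𝓘 (24/5) (1/100) (1/8) τ T ∧ 2τ < s₀ ∧ HostSep ∧
r + 2τ ≤ 7 ∧ HostFarTab ∧ TailCert ∧ (Xh + Xe ≤ X) ∧ PairAdm r Pm ∧ (START-G) DiffEvalTabG … (boxTabG T) (P 0) ∧ (STAGE-G) ∀ i < n, StageCertG … (addCol X (P i)) (P (i+1)) ∧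
(CERT-G) SlackCertG … 0 σ₁ … (addCol X (P n)) ∧ AnnularPhaseFloor ∧ PolyTextureFloor ∧ AnnularDefectFloor ∧ DefectiveCollarFloor ∧ CC∪T₀ ∧ DD∪T₀` (`0 ≤ τ`).
ONE TERM over the [CORE-FAR] junction: `hC := …GradedStage.coreOff_of_envelope_tailCert_pairTabsG …`. [folklore instantiation] -/
theorem aperiodicFrustratedLawGap_of_entryTreesU_of_envelope_tailCert_pairTabsG {𝓘 : ChartFam} {T : SlackTab} {τ s₀ r : ℝ} {X Xh Xe : SlackTab}
    {Pm : PairMap} {εE CE DE DX : ℝ} (P : ℕ → SlackTab) (n : ℕ) (hτ : 0 ≤ τ)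
    (hε0 : 0 < εE) (hε1 : εE ≤ 1 / 10000) (hU : PeriodicEnergyCeiling (-(7175 / 10000))) (hDX : 0 ≤ DX)
    (hE : SchurElasticPricingX (1 / 20) (1 / 8) w₄₅ ω₄ (3 / 400) (-(7175 / 10000)) (1 / 10000) CE DE DX (LocOptFails eStar εE (3 / 2) 1))
    (Pc : ((Fin 3 × Fin 3) ⊕ Fin 3 → ℤ) → ((Fin 3 × Fin 3) ⊕ Fin 3 → ℤ) → HTCert)
    (Qf : ((Fin 3 × Fin 3) ⊕ Fin 3 → ℤ) → ((Fin 3 × Fin 3) ⊕ Fin 3 → ℤ) → (Fin 4 → ℤ))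
    (Tc : ((Fin 3 × Fin 3) ⊕ Fin 3 → ℤ) → ((Fin 3 × Fin 3) ⊕ Fin 3 → ℤ) → CertTree ((Fin 3 × Fin 3) ⊕ Fin 3))
    (hFcc : ∃ t : CertTree (Fin 3 × Fin 3), treeOK (entryLeafOK6RBKP muRec) t rootC rootW = true)
    (hHcp : ∃ t : CertTree ((Fin 3 × Fin 3) ⊕ Fin 3), treeOK (entryLeafOKHT4UQDCRX muRec Pc Qf Tc) t rootCH rootWH = true)
    (hT : TailPenalty (24 / 5) (1 / 1000)) (hRl : CoreCoreRelief (63 / 10) (63 / 10) (24 / 5) (1 / 100) (3 / 5000))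
    (hcov : FamilyCoverG 𝓘 (24 / 5) (1 / 100) (1 / 8) τ T) (hτs : 2 * τ < s₀) (hsep : HostSep 𝓘 s₀) (hr7 : r + 2 * τ ≤ 7)
    (hH : HostFarTab 𝓘 τ r Xh) (hTl : TailCert 𝓘 τ Xe)
    (hdom : ∀ (M₀ : ℕ) (z₀ : Fin M₀ → E3) (c₀ h : Fin M₀), Xh M₀ z₀ c₀ h + Xe M₀ z₀ c₀ h ≤ X M₀ z₀ c₀ h) (hPm : PairAdm r Pm)
    (h0 : DiffEvalTabG 𝓘 τ T bondD3 (cubicTail fun s => gammaMaj (s - 2 * τ)) r (boxTabG T) (P 0))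
    (hs : ∀ i : ℕ, i < n → StageCertG 𝓘 τ T sigmaOne bondD3 (cubicTail fun s => gammaMaj (s - 2 * τ)) r hessBlk0 force0 Pm (addCol X (P i)) (P (i + 1)))
    (hcert : SlackCertG 𝓘 τ T 0 sigmaOne hessBlk0 force0 (addCol X (P n)))
    (hF : AnnularPhaseFloor (63 / 10) (24 / 5) (63 / 10) (1 / 1000)) (hP : PolyTextureFloor (63 / 10) (24 / 5) (1 / 1000))
    (hA : AnnularDefectFloor (24 / 5) (63 / 10)) (hD : DefectiveCollarFloor (24 / 5))
    (h2 : CrowdedCoreMotifPricingCapK (1 / 1000) (9 / 5) (133 / 10) (3 / 2) (effPot w₄₅ ω₄ (3 / 400)) (-(7175 / 10000) + 3 / 400)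
      (Collar (9 / 2) fun N y j => (∃ s : ℝ, 0 ≤ s ∧ s ≤ 3 / 2 ∧ NonEquilibriumCore (-(7175 / 10000)) 0 7 s (1 / 10000) N y j) ∨
        GoodAtScale (1 / 20) (3 / 2) y j))
    (h3 : DiluteDefectMotifPricingCapK (1 / 1000) (9 / 5) (133 / 10) (3 / 2) (effPot w₄₅ ω₄ (3 / 400)) (-(7175 / 10000) + 3 / 400)
      (Collar (9 / 2) fun N y j => (∃ s : ℝ, 0 ≤ s ∧ s ≤ 3 / 2 ∧ NonEquilibriumCore (-(7175 / 10000)) 0 7 s (1 / 10000) N y j) ∨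
        GoodAtScale (1 / 20) (3 / 2) y j)) :
    Summit.AtomisticToContinuum.Crystallization.Theses.FrustratedLawDichotomy.AperiodicFrustratedLawGap :=
  aperiodicFrustratedLawGap_of_entryTreesHTU_of_coreOff hε0 hε1 hU hDX hE Pc Qf Tc hFcc hHcp hT hRl
    (coreOff_of_envelope_tailCert_pairTabsG P n hτ hcov hτs hsep hr7 hH hTl hdom hPm h0 hs hcert) hF hP hA hD h2 h3

/-- ★★ **Periodic sibling (27624)** of the graded-stage junction. [folklore instantiation] -/
theorem periodicFrustratedLawGap_of_entryTreesU_of_envelope_tailCert_pairTabsG {𝓘 : ChartFam} {T : SlackTab} {τ s₀ r : ℝ} {X Xh Xe : SlackTab}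
    {Pm : PairMap} {εE CE DE DX : ℝ} (P : ℕ → SlackTab) (n : ℕ) (hτ : 0 ≤ τ)
    (hε0 : 0 < εE) (hε1 : εE ≤ 1 / 10000) (hU : PeriodicEnergyCeiling (-(7175 / 10000))) (hDX : 0 ≤ DX)
    (hE : SchurElasticPricingX (1 / 20) (1 / 8) w₄₅ ω₄ (3 / 400) (-(7175 / 10000)) (1 / 10000) CE DE DX (LocOptFails eStar εE (3 / 2) 1))
    (Pc : ((Fin 3 × Fin 3) ⊕ Fin 3 → ℤ) → ((Fin 3 × Fin 3) ⊕ Fin 3 → ℤ) → HTCert)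
    (Qf : ((Fin 3 × Fin 3) ⊕ Fin 3 → ℤ) → ((Fin 3 × Fin 3) ⊕ Fin 3 → ℤ) → (Fin 4 → ℤ))
    (Tc : ((Fin 3 × Fin 3) ⊕ Fin 3 → ℤ) → ((Fin 3 × Fin 3) ⊕ Fin 3 → ℤ) → CertTree ((Fin 3 × Fin 3) ⊕ Fin 3))
    (hFcc : ∃ t : CertTree (Fin 3 × Fin 3), treeOK (entryLeafOK6RBKP muRec) t rootC rootW = true)
    (hHcp : ∃ t : CertTree ((Fin 3 × Fin 3) ⊕ Fin 3), treeOK (entryLeafOKHT4UQDCRX muRec Pc Qf Tc) t rootCH rootWH = true)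
    (hT : TailPenalty (24 / 5) (1 / 1000)) (hRl : CoreCoreRelief (63 / 10) (63 / 10) (24 / 5) (1 / 100) (3 / 5000))
    (hcov : FamilyCoverG 𝓘 (24 / 5) (1 / 100) (1 / 8) τ T) (hτs : 2 * τ < s₀) (hsep : HostSep 𝓘 s₀) (hr7 : r + 2 * τ ≤ 7)
    (hH : HostFarTab 𝓘 τ r Xh) (hTl : TailCert 𝓘 τ Xe)
    (hdom : ∀ (M₀ : ℕ) (z₀ : Fin M₀ → E3) (c₀ h : Fin M₀), Xh M₀ z₀ c₀ h + Xe M₀ z₀ c₀ h ≤ X M₀ z₀ c₀ h) (hPm : PairAdm r Pm)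
    (h0 : DiffEvalTabG 𝓘 τ T bondD3 (cubicTail fun s => gammaMaj (s - 2 * τ)) r (boxTabG T) (P 0))
    (hs : ∀ i : ℕ, i < n → StageCertG 𝓘 τ T sigmaOne bondD3 (cubicTail fun s => gammaMaj (s - 2 * τ)) r hessBlk0 force0 Pm (addCol X (P i)) (P (i + 1)))
    (hcert : SlackCertG 𝓘 τ T 0 sigmaOne hessBlk0 force0 (addCol X (P n)))
    (hF : AnnularPhaseFloor (63 / 10) (24 / 5) (63 / 10) (1 / 1000)) (hP : PolyTextureFloor (63 / 10) (24 / 5) (1 / 1000))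
    (hA : AnnularDefectFloor (24 / 5) (63 / 10)) (hD : DefectiveCollarFloor (24 / 5))
    (h2 : CrowdedCoreMotifPricingCapK (1 / 1000) (9 / 5) (133 / 10) (3 / 2) (effPot w₄₅ ω₄ (3 / 400)) (-(7175 / 10000) + 3 / 400)
      (Collar (9 / 2) fun N y j => (∃ s : ℝ, 0 ≤ s ∧ s ≤ 3 / 2 ∧ NonEquilibriumCore (-(7175 / 10000)) 0 7 s (1 / 10000) N y j) ∨
        GoodAtScale (1 / 20) (3 / 2) y j))
    (h3 : DiluteDefectMotifPricingCapK (1 / 1000) (9 / 5) (133 / 10) (3 / 2) (effPot w₄₅ ω₄ (3 / 400)) (-(7175 / 10000) + 3 / 400)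
      (Collar (9 / 2) fun N y j => (∃ s : ℝ, 0 ≤ s ∧ s ≤ 3 / 2 ∧ NonEquilibriumCore (-(7175 / 10000)) 0 7 s (1 / 10000) N y j) ∨
        GoodAtScale (1 / 20) (3 / 2) y j)) :
    Summit.AtomisticToContinuum.Crystallization.Theses.FrustratedLawDichotomy.PeriodicFrustratedLawGap :=
  periodicFrustratedLawGap_of_entryTreesHTU_of_coreOff hε0 hε1 hU hDX hE Pc Qf Tc hFcc hHcp hT hRl
    (coreOff_of_envelope_tailCert_pairTabsG P n hτ hcov hτs hsep hr7 hH hTl hdom hPm h0 hs hcert) hF hP hA hD h2 h3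

/-! ## §2 ★★ The census cell: `τ = 1/100`, `T = gradeTol R_g τ_in (1/100)` -/

/-- ★★ **27623 FROM THE ENTRY TREES AND THE TWO-LEVEL GRADED CELL `(R_g, τ_in)` IN TABLE CURRENCY** — (BC-G) COVER-G ∧ (START-G) on the graded box ∧
(STAGE-G)ᵢ GRAD-77 on the graded global row polytope ∧ (CERT-G) the graded terminal LP, all in the SAME cell, with the R1⁗ data, the E-spine, the collar
floors and the caps ⟹ crux.  `hC := …GradedStage.coreOff_record_of_gradeTol_pairTabs R_g τ_in P n …`. [folklore instantiation] -/
theorem aperiodicFrustratedLawGap_of_entryTreesU_of_gradeTol_pairTabs {𝓘 : ChartFam} (Rg τin : ℝ) {s₀ r : ℝ} {X Xh Xe : SlackTab} {Pm : PairMap}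
    {εE CE DE DX : ℝ} (P : ℕ → SlackTab) (n : ℕ)
    (hε0 : 0 < εE) (hε1 : εE ≤ 1 / 10000) (hU : PeriodicEnergyCeiling (-(7175 / 10000))) (hDX : 0 ≤ DX)
    (hE : SchurElasticPricingX (1 / 20) (1 / 8) w₄₅ ω₄ (3 / 400) (-(7175 / 10000)) (1 / 10000) CE DE DX (LocOptFails eStar εE (3 / 2) 1))
    (Pc : ((Fin 3 × Fin 3) ⊕ Fin 3 → ℤ) → ((Fin 3 × Fin 3) ⊕ Fin 3 → ℤ) → HTCert)
    (Qf : ((Fin 3 × Fin 3) ⊕ Fin 3 → ℤ) → ((Fin 3 × Fin 3) ⊕ Fin 3 → ℤ) → (Fin 4 → ℤ))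
    (Tc : ((Fin 3 × Fin 3) ⊕ Fin 3 → ℤ) → ((Fin 3 × Fin 3) ⊕ Fin 3 → ℤ) → CertTree ((Fin 3 × Fin 3) ⊕ Fin 3))
    (hFcc : ∃ t : CertTree (Fin 3 × Fin 3), treeOK (entryLeafOK6RBKP muRec) t rootC rootW = true)
    (hHcp : ∃ t : CertTree ((Fin 3 × Fin 3) ⊕ Fin 3), treeOK (entryLeafOKHT4UQDCRX muRec Pc Qf Tc) t rootCH rootWH = true)
    (hT : TailPenalty (24 / 5) (1 / 1000)) (hRl : CoreCoreRelief (63 / 10) (63 / 10) (24 / 5) (1 / 100) (3 / 5000))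
    (hcov : FamilyCoverG 𝓘 (24 / 5) (1 / 100) (1 / 8) (1 / 100) (gradeTol Rg τin (1 / 100))) (hτs : 2 * (1 / 100 : ℝ) < s₀) (hsep : HostSep 𝓘 s₀)
    (hr7 : r + 2 * (1 / 100 : ℝ) ≤ 7) (hH : HostFarTab 𝓘 (1 / 100) r Xh) (hTl : TailCert 𝓘 (1 / 100) Xe)
    (hdom : ∀ (M₀ : ℕ) (z₀ : Fin M₀ → E3) (c₀ h : Fin M₀), Xh M₀ z₀ c₀ h + Xe M₀ z₀ c₀ h ≤ X M₀ z₀ c₀ h) (hPm : PairAdm r Pm)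
    (h0 : DiffEvalTabG 𝓘 (1 / 100) (gradeTol Rg τin (1 / 100)) bondD3 (cubicTail fun s => gammaMaj (s - 2 * (1 / 100))) r
      (boxTabG (gradeTol Rg τin (1 / 100))) (P 0))
    (hs : ∀ i : ℕ, i < n → StageCertG 𝓘 (1 / 100) (gradeTol Rg τin (1 / 100)) sigmaOne bondD3 (cubicTail fun s => gammaMaj (s - 2 * (1 / 100))) r
      hessBlk0 force0 Pm (addCol X (P i)) (P (i + 1)))
    (hcert : SlackCertG 𝓘 (1 / 100) (gradeTol Rg τin (1 / 100)) 0 sigmaOne hessBlk0 force0 (addCol X (P n)))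
    (hF : AnnularPhaseFloor (63 / 10) (24 / 5) (63 / 10) (1 / 1000)) (hP : PolyTextureFloor (63 / 10) (24 / 5) (1 / 1000))
    (hA : AnnularDefectFloor (24 / 5) (63 / 10)) (hD : DefectiveCollarFloor (24 / 5))
    (h2 : CrowdedCoreMotifPricingCapK (1 / 1000) (9 / 5) (133 / 10) (3 / 2) (effPot w₄₅ ω₄ (3 / 400)) (-(7175 / 10000) + 3 / 400)
      (Collar (9 / 2) fun N y j => (∃ s : ℝ, 0 ≤ s ∧ s ≤ 3 / 2 ∧ NonEquilibriumCore (-(7175 / 10000)) 0 7 s (1 / 10000) N y j) ∨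
        GoodAtScale (1 / 20) (3 / 2) y j))
    (h3 : DiluteDefectMotifPricingCapK (1 / 1000) (9 / 5) (133 / 10) (3 / 2) (effPot w₄₅ ω₄ (3 / 400)) (-(7175 / 10000) + 3 / 400)
      (Collar (9 / 2) fun N y j => (∃ s : ℝ, 0 ≤ s ∧ s ≤ 3 / 2 ∧ NonEquilibriumCore (-(7175 / 10000)) 0 7 s (1 / 10000) N y j) ∨
        GoodAtScale (1 / 20) (3 / 2) y j)) :
    Summit.AtomisticToContinuum.Crystallization.Theses.FrustratedLawDichotomy.AperiodicFrustratedLawGap :=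
  aperiodicFrustratedLawGap_of_entryTreesHTU_of_coreOff hε0 hε1 hU hDX hE Pc Qf Tc hFcc hHcp hT hRl
    (coreOff_record_of_gradeTol_pairTabs Rg τin P n hcov hτs hsep hr7 hH hTl hdom hPm h0 hs hcert) hF hP hA hD h2 h3

/-! ## §3 Sanity: GradStep's uniform record through the graded one -/

/-- (R2) At the constant table the graded-stage junction is fed by GradStep's UNIFORM record data (`…GradedStage.coreOff_of_envelope_tailCert_pairTabs_via_graded`):
§1's content contains `…RecordJunctionStage` §2. [formal bookkeeping] -/
example {𝓘 : ChartFam} {τ s₀ r : ℝ} {X Xh Xe : SlackTab} {Pm : PairMap} {εE CE DE DX : ℝ} (P : ℕ → SlackTab) (n : ℕ) (hτ : 0 ≤ τ)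
    (hε0 : 0 < εE) (hε1 : εE ≤ 1 / 10000) (hU : PeriodicEnergyCeiling (-(7175 / 10000))) (hDX : 0 ≤ DX)
    (hE : SchurElasticPricingX (1 / 20) (1 / 8) w₄₅ ω₄ (3 / 400) (-(7175 / 10000)) (1 / 10000) CE DE DX (LocOptFails eStar εE (3 / 2) 1))
    (Pc : ((Fin 3 × Fin 3) ⊕ Fin 3 → ℤ) → ((Fin 3 × Fin 3) ⊕ Fin 3 → ℤ) → HTCert)
    (Qf : ((Fin 3 × Fin 3) ⊕ Fin 3 → ℤ) → ((Fin 3 × Fin 3) ⊕ Fin 3 → ℤ) → (Fin 4 → ℤ))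
    (Tc : ((Fin 3 × Fin 3) ⊕ Fin 3 → ℤ) → ((Fin 3 × Fin 3) ⊕ Fin 3 → ℤ) → CertTree ((Fin 3 × Fin 3) ⊕ Fin 3))
    (hFcc : ∃ t : CertTree (Fin 3 × Fin 3), treeOK (entryLeafOK6RBKP muRec) t rootC rootW = true)
    (hHcp : ∃ t : CertTree ((Fin 3 × Fin 3) ⊕ Fin 3), treeOK (entryLeafOKHT4UQDCRX muRec Pc Qf Tc) t rootCH rootWH = true)
    (hT : TailPenalty (24 / 5) (1 / 1000)) (hRl : CoreCoreRelief (63 / 10) (63 / 10) (24 / 5) (1 / 100) (3 / 5000))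
    (hcov : FamilyCover 𝓘 (24 / 5) (1 / 100) (1 / 8) τ) (hτs : 2 * τ < s₀) (hsep : HostSep 𝓘 s₀) (hr7 : r + 2 * τ ≤ 7)
    (hH : HostFarTab 𝓘 τ r Xh) (hTl : TailCert 𝓘 τ Xe)
    (hdom : ∀ (M₀ : ℕ) (z₀ : Fin M₀ → E3) (c₀ h : Fin M₀), Xh M₀ z₀ c₀ h + Xe M₀ z₀ c₀ h ≤ X M₀ z₀ c₀ h) (hPm : PairAdm r Pm)
    (h0 : DiffEvalTab 𝓘 τ bondD3 (cubicTail fun s => gammaMaj (s - 2 * τ)) r (boxTab τ) (P 0))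
    (hs : ∀ i : ℕ, i < n → StageCert 𝓘 τ sigmaOne bondD3 (cubicTail fun s => gammaMaj (s - 2 * τ)) r hessBlk0 force0 Pm (addCol X (P i)) (P (i + 1)))
    (hcert : SlackCert 𝓘 τ 0 sigmaOne hessBlk0 force0 (addCol X (P n)))
    (hF : AnnularPhaseFloor (63 / 10) (24 / 5) (63 / 10) (1 / 1000)) (hP : PolyTextureFloor (63 / 10) (24 / 5) (1 / 1000))
    (hA : AnnularDefectFloor (24 / 5) (63 / 10)) (hD : DefectiveCollarFloor (24 / 5))
    (h2 : CrowdedCoreMotifPricingCapK (1 / 1000) (9 / 5) (133 / 10) (3 / 2) (effPot w₄₅ ω₄ (3 / 400)) (-(7175 / 10000) + 3 / 400)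
      (Collar (9 / 2) fun N y j => (∃ s : ℝ, 0 ≤ s ∧ s ≤ 3 / 2 ∧ NonEquilibriumCore (-(7175 / 10000)) 0 7 s (1 / 10000) N y j) ∨
        GoodAtScale (1 / 20) (3 / 2) y j))
    (h3 : DiluteDefectMotifPricingCapK (1 / 1000) (9 / 5) (133 / 10) (3 / 2) (effPot w₄₅ ω₄ (3 / 400)) (-(7175 / 10000) + 3 / 400)
      (Collar (9 / 2) fun N y j => (∃ s : ℝ, 0 ≤ s ∧ s ≤ 3 / 2 ∧ NonEquilibriumCore (-(7175 / 10000)) 0 7 s (1 / 10000) N y j) ∨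
        GoodAtScale (1 / 20) (3 / 2) y j)) :
    Summit.AtomisticToContinuum.Crystallization.Theses.FrustratedLawDichotomy.AperiodicFrustratedLawGap :=
  aperiodicFrustratedLawGap_of_entryTreesHTU_of_coreOff hε0 hε1 hU hDX hE Pc Qf Tc hFcc hHcp hT hRl
    (coreOff_of_envelope_tailCert_pairTabs_via_graded P n hτ hcov hτs hsep hr7 hH hTl hdom hPm h0 hs hcert) hF hP hA hD h2 h3

end Summit.AtomisticToContinuum.Crystallization.Theorems.FrustratedLawDichotomyAperiodicGapRecordJunctionGradedStage

end
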